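import Summits.QuantumFields.BalabanUV.Beta.GAN24.BornBorderDrift
import Summits.QuantumFields.BalabanUV.Beta.GAN24.SrecAtRowHoldsFinal

/-!
# `BalabanUV.Beta.GAN24.BornBorderDriftThree` — binder row G-an2-4 ∕ (CONV-C), CT-ROUTE (R8°), THE RATE HALF OF THE V-BORN (BORDER) ROW, PART 2 (`d = 3`):
# **`hBdev(cVH,0)` OF THE `d = 3` COMB FAMILY ⟸ THE TOP-ALIGNED V PAIR LETTERS WITH BIRTHS `≥ 1` ALONE** — the undressed V letter, the top lineage and the pair
# `i = 0` DISCHARGED from tree names (PART 1 = `BornBorderDrift`, the generic sockets)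

NOT IN PRINT; OUR BOOKKEEPING (G-an2-4 formalisation swarm → CRUX TEAM (2), leaf prover `b2b-balaban-gan24-formalise-leaf-04`, gen 57; journal
`CLAIMS.log` INTENT «BORN-V-DRIFT SOCKET» [LEAF04-G57-INTENT1]).  HONEST FRAMING (cell contract, verbatim): «discharging `BetaPertH` makes Bałaban's UV
stability UNCONDITIONAL — a real constructive-QFT result; it is NOT the continuum limit and NOT the Clay problem.»  HONEST DEPENDENCY (verbatim):
«continuum YM on T⁴ ⇐ BetaPertH ∧ nine spine estimates (0/9 proved); BetaPertH ⇐ (D1) ∧ (D4) ∧ CAP+tail; G-an2-4 gates asym, D1 and NE2/3/4.»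
[folklore] assembly BY NAME over PART 1's sockets `BornBorderDrift.exists_hBdevV_of_letters` ∕ `exists_hBdevV_of_supLetters`, the owner gan24-p1 g21's
`BornBorderUndressedRow.exists_hUgV_of_rootedRows` with gan24-p2 g33's three rooted symmetric-table V rows (`rowV_three_at`, `shapeVt_three_at`, `shapeV0_at`), his
hypothesis-free V row `SrecAtRowHoldsFinal.exists_hBv_three` (p304664) and leaf-03 g55's (V-C) END `BornBorderContactBound.exists_hCgV_three`; 0 `def`, 0 cited facts,
0 `def … : Prop`, 0 sorry; NO estimate of Bałaban's; discharges NOTHING of (hS, hSall) on (E): the ENDs are SOCKETS whose one hypothesis (the V pair letters,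
births `≥ 1`) is OPEN.  NEVER «G-an2-4 closed» as (CONV-C); NOT D1, NOT `BetaPertH`, NOT continuum, NOT Clay.

## Contents (`d = 3`, `2 ≤ Lc`, pin `cE = Lc^4`, every `cVH`, every in-block root)
`locStencil_add_pi` (plumbing); `exists_hUgV_three` (the owner's undressed V letter `hUgV`, hypothesis-free — the by-name junction the capstone inlines);
`exists_lineage_v_three` (every V lineage `D(i,k) = U + (D − U)` is a local stencil family with the two letters added); **`exists_hT_v_three`** (the TOP lineage
is geometric with one log: `(C₁ + C₂)·(k+1)·θT^{k+1}`); **`exists_pairZero_v_three`** (the pair `i = 0` is FREE: both members by the letters, `C·k·Θ^k`; PART 1's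
`hP` at `i = 0` VERBATIM, raw indices); ENDs **`exists_hBdevV_three_of_pairs`** (`LocStencil` pairs, all `i < k`) and **`exists_hBdevV_three_of_supPairs`**
(`hBdev(cVH,0) ⟸ THE SUP-NORM V PAIR LETTERS WITH BIRTHS ≥ 1 ALONE`: hB(cVH,0) = the owner's `exists_hBv_three`, top by `exists_hT_v_three`, `i = 0` by
`exists_pairZero_v_three`, folded with exponent `q+1`).
THE PAIR LETTER (for its typists; NOT proved here): per lineage ONE differenced factor at a time — the UNDRESSED V pairs are `Lc^4 ×` road S3's rooted
symmetric-table DIFF rows (`S3DiffV` ∕ `S3DiffVLegs` are the corner-root instances) through the owner's `lineage_v_succ∕zero∕top_pin_apply`; the CONTACT V pairs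
are leaf-03's (V-C) cells with one slot differenced (the twin of leaf-01 g61's (C4)-DIFF).
Unit `b2b-balaban-gan24-formalise-leaf-04` (gen 57), 2026-08-21.
-/

noncomputable section

open Finset
open scoped BigOperators
open Literature.MathematicalPhysics.QuantumFieldTheory
open Literature.MathematicalPhysics.QuantumFieldTheory.Balaban1983to89
open Literature.MathematicalPhysics.QuantumFieldTheory.Balaban1983to89.Beta
open ExpKernelCalculus (MKer)
open OneStepResolventKernel (Fib LocStencil)
open AffineAveraging (box toSite)
open AveragingHessianKernelsRooted (vhSAt)
open StepJetData (locStencil_add)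
open BalabanCompositeJets (respStep)
open Summit.QuantumFields.BalabanUV.Beta.HessKerDressedUnits (unitS)
open Summit.QuantumFields.BalabanUV.Beta.GAN24.CombesThomas (sfStep smStep KStepUnit SupBound)
open Summit.QuantumFields.BalabanUV.Beta.GAN24.StencilSlotOfShapes (locStencil_mono')
open Summit.QuantumFields.BalabanUV.Beta.GAN24.StencilSlotCauchyOfShapes (locStencil_sub)
open Summit.QuantumFields.BalabanUV.Beta.GAN24.Push3 (push₃)
open Summit.QuantumFields.BalabanUV.Beta.GAN24.SrecLinearPartEq (colM rowMM reslot)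
open Summit.QuantumFields.BalabanUV.Beta.GAN24.SrecWilsonSector (bornSecAt)
open Summit.QuantumFields.BalabanUV.Beta.GAN24.SrecBornSector (unitStepMap)
open Summit.QuantumFields.BalabanUV.Beta.GAN24.AffineUnroll (transport)
open Summit.QuantumFields.BalabanUV.Beta.GAN24.BornLambdaDriftSup (locStencil_zero_iff_supBound locStencil_zero_of_locStencil)
open Summit.QuantumFields.BalabanUV.Beta.GAN24.BornBorderUndressedRow (exists_hUgV_of_rootedRows)
open Summit.QuantumFields.BalabanUV.Beta.GAN24.TaylorRowVSymAt (rowV_three_at)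
open Summit.QuantumFields.BalabanUV.Beta.GAN24.S3ShapeVtSymAt (shapeVt_three_at)
open Summit.QuantumFields.BalabanUV.Beta.GAN24.S3RowV0SymAt (shapeV0_at)
open Summit.QuantumFields.BalabanUV.Beta.GAN24.BornBorderContactBound (exists_hCgV_three)
open Summit.QuantumFields.BalabanUV.Beta.GAN24.SrecAtRowHoldsFinal (abs_cE_le exists_hBv_three)
open Summit.QuantumFields.BalabanUV.Beta.GAN24.BornBorderDrift (exists_hBdevV_of_letters exists_hBdevV_of_supLetters)

namespace Summit.QuantumFields.BalabanUV.Beta.GAN24.BornBorderDriftThree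

variable {d : ℕ} {Lc : ℕ} [NeZero Lc]

/-! ## `d = 3`: the undressed V letter and the top lineage discharged; the pair `i = 0` free; the END sockets -/

/-- [folklore] `locStencil_add` with the sum written as `A + B` (pointwise addition of stencil families). -/
theorem locStencil_add_pi {A B : Fin (d + 1) → (Fin (d + 1) → ℤ) → MKer (d + 1) (Fib d)} {C C' δ : ℝ}
    (hA : LocStencil A C δ) (hB : LocStencil B C' δ) : LocStencil (A + B) (C + C') δ :=
  locStencil_add hA hB

/-- NOT IN PRINT; OUR BOOKKEEPING (`d = 3`, `2 ≤ Lc`, pin `cE = Lc^4`, UNCONDITIONAL; a by-name junction).  **THE UNDRESSED V-LINEAGE LETTER `hUgV` OF THE `d = 3`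
COMB FAMILY**: the owner's `BornBorderUndressedRow.exists_hUgV_of_rootedRows` fed with gan24-p2 g33's three rooted symmetric-table V rows `TaylorRowVSymAt.rowV_three_at`,
`S3ShapeVtSymAt.shapeVt_three_at`, `S3RowV0SymAt.shapeV0_at` (exactly as the capstone `SrecAtBornRowHolds` inlines it). -/
theorem exists_hUgV_three (hLc : 2 ≤ Lc) {cE : ℝ} (hcE : cE = (Lc : ℝ) ^ (3 + 1)) (cVH : ℝ) :
    ∃ C θ δ : ℝ, 0 ≤ C ∧ 0 ≤ θ ∧ θ < 1 ∧ 0 < δ ∧ ∀ (rr : Fin (3 + 1) → ℕ), rr ∈ box (3 + 1) Lc → ∀ k i : ℕ, i < k →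
      LocStencil (fun κ' u' => (cE * (Lc : ℝ) ^ (2 * (3 + 1))) ^ (k - i) •
        push₃ (respStep (d := 3) (Lc ^ (i + 1)) (Lc ^ k)) (respStep (d := 3) (Lc ^ (i + 1)) (Lc ^ k)) (respStep (d := 3) (Lc ^ (i + 1)) (Lc ^ k))
          (fun κ u => -(push₃ (-respStep (d := 3) (Lc ^ i) (Lc ^ (i + 1))) (colM (KStepUnit (d := 3) Lc i) Lc)
                (respStep (d := 3) (Lc ^ i) (Lc ^ (i + 1))) (reslot Sum.inl Sum.inr fun κ u => cVH • vhSAt (toSite rr) 3 Lc rfl κ u) κ u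
            + push₃ (rowMM (KStepUnit (d := 3) Lc i) Lc) (respStep (d := 3) (Lc ^ i) (Lc ^ (i + 1)))
                (respStep (d := 3) (Lc ^ i) (Lc ^ (i + 1))) (reslot Sum.inr Sum.inl fun κ u => cVH • vhSAt (toSite rr) 3 Lc rfl κ u) κ u)) κ' u')
        (C * θ ^ (k - i)) δ :=
  exists_hUgV_of_rootedRows hLc hcE cVH (rowV_three_at hLc cVH) (shapeVt_three_at (le_trans (by norm_num) hLc) cVH)
    (shapeV0_at (le_trans (by norm_num) hLc) cVH)

/-- NOT IN PRINT; OUR BOOKKEEPING (`d = 3`, `2 ≤ Lc`, pin `cE = Lc^4`; for every `i < k`, UNCONDITIONAL).  **EVERY V LINEAGE IS A LOCAL STENCIL FAMILY WITH THE TWO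
LETTERS ADDED**: `D(i,k) = U(i,k) + (D(i,k) − U(i,k))` — undressed (`exists_hUgV_three`: `C₁·θ₁^{k−i}`) plus contact (leaf-03 g55's
`BornBorderContactBound.exists_hCgV_three`: `C₂·(k−i)·θ₂^{k−i}`), at the smaller rate. -/
theorem exists_lineage_v_three (hLc : 2 ≤ Lc) {cE : ℝ} (hcE : cE = (Lc : ℝ) ^ (3 + 1)) (cVH : ℝ) :
    ∃ C₁ θ₁ C₂ θ₂ δ : ℝ, 0 ≤ C₁ ∧ 0 ≤ θ₁ ∧ θ₁ < 1 ∧ 0 ≤ C₂ ∧ 0 ≤ θ₂ ∧ θ₂ < 1 ∧ 0 < δ ∧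
      ∀ (rr : Fin (3 + 1) → ℕ), rr ∈ box (3 + 1) Lc → ∀ k i : ℕ, i < k →
        LocStencil (transport (unitStepMap Lc (toSite rr) cE) (i + 1) (k - 1 - i)
          (unitStepMap Lc (toSite rr) cE i (fun κ u => cVH • vhSAt (toSite rr) 3 Lc rfl κ u)))
          (C₁ * θ₁ ^ (k - i) + C₂ * ((((k - i : ℕ) : ℝ)) ^ 1 * θ₂ ^ (k - i))) δ := by
  obtain ⟨C₁, θ₁, δ₁, hC₁, hθ₁0, hθ₁1, hδ₁, hU⟩ := exists_hUgV_three hLc hcE cVH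
  obtain ⟨C₂, θ₂, δ₂, hC₂, hθ₂0, hθ₂1, hδ₂, hCg⟩ := exists_hCgV_three hLc cE cVH (abs_cE_le hcE)
  refine ⟨C₁, θ₁, C₂, θ₂, min δ₁ δ₂, hC₁, hθ₁0, hθ₁1, hC₂, hθ₂0, hθ₂1, lt_min hδ₁ hδ₂, fun rr hrr k i hik => ?_⟩
  have h1 := locStencil_mono' (hU rr hrr k i hik) le_rfl (min_le_left δ₁ δ₂)
  have h2 := locStencil_mono' (hCg rr hrr k i hik) le_rfl (min_le_right δ₁ δ₂)
  have h := locStencil_add_pi h1 h2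
  rwa [add_sub_cancel] at h

/-- NOT IN PRINT; OUR BOOKKEEPING (`d = 3`, `2 ≤ Lc`, pin `cE = Lc^4`, UNCONDITIONAL).  **THE TOP V LINEAGE IS GEOMETRIC WITH ONE LOG**: member `k+1`'s lineage born
at the finest level, `transport (unitStepMap …) 1 k (unitStepMap … 0 V)` = undressed (`exists_hUgV_three` at `(k+1, 0)`: `C₁·θ₁^{k+1}`) + contact (`exists_hCgV_three`
at `(k+1, 0)`: `C₂·(k+1)·θ₂^{k+1}`) ⇒ constant `(C₁ + C₂)·(k+1)·θT^{k+1}`, `θT = max θ₁ θ₂`, uniformly in the in-block root — the `hT` letter of §1 at `p = 1`. -/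
theorem exists_hT_v_three (hLc : 2 ≤ Lc) {cE : ℝ} (hcE : cE = (Lc : ℝ) ^ (3 + 1)) (cVH : ℝ) :
    ∃ CT θT δT : ℝ, 0 ≤ CT ∧ 0 ≤ θT ∧ θT < 1 ∧ 0 < δT ∧ ∀ (rr : Fin (3 + 1) → ℕ), rr ∈ box (3 + 1) Lc → ∀ k : ℕ,
      LocStencil (transport (unitStepMap Lc (toSite rr) cE) 1 k
        (unitStepMap Lc (toSite rr) cE 0 (fun κ u => cVH • vhSAt (toSite rr) 3 Lc rfl κ u))) (CT * ((((k + 1 : ℕ) : ℝ)) ^ 1 * θT ^ (k + 1))) δT := by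
  obtain ⟨C₁, θ₁, C₂, θ₂, δ, hC₁, hθ₁0, hθ₁1, hC₂, hθ₂0, hθ₂1, hδ, hD⟩ := exists_lineage_v_three hLc hcE cVH
  set θT : ℝ := max θ₁ θ₂ with hθT
  have hθT0 : 0 ≤ θT := le_max_of_le_left hθ₁0
  have hθT1 : θT < 1 := max_lt hθ₁1 hθ₂1
  refine ⟨C₁ + C₂, θT, δ, by positivity, hθT0, hθT1, hδ, fun rr hrr k => ?_⟩
  have h := hD rr hrr (k + 1) 0 (Nat.zero_lt_succ k)
  rw [show k + 1 - 1 - 0 = k by omega, show k + 1 - 0 = k + 1 by omega] at h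
  refine locStencil_mono' h ?_ le_rfl
  -- `C₁ θ₁^(k+1) + C₂ (k+1) θ₂^(k+1) ≤ (C₁ + C₂) (k+1) θT^(k+1)`
  have hk1 : (1 : ℝ) ≤ ((k + 1 : ℕ) : ℝ) := by exact_mod_cast Nat.succ_le_succ (Nat.zero_le k)
  have hp1 : θ₁ ^ (k + 1) ≤ θT ^ (k + 1) := pow_le_pow_left₀ hθ₁0 (le_max_left _ _) _
  have hp2 : θ₂ ^ (k + 1) ≤ θT ^ (k + 1) := pow_le_pow_left₀ hθ₂0 (le_max_right _ _) _
  have hTk : 0 ≤ θT ^ (k + 1) := pow_nonneg hθT0 _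
  push_cast at hk1 ⊢
  nlinarith [mul_nonneg hC₁ hTk, mul_nonneg hC₂ hTk, mul_le_mul_of_nonneg_left hp1 hC₁, mul_le_mul_of_nonneg_left hp2 hC₂,
    mul_nonneg (mul_nonneg hC₁ hTk) (sub_nonneg.2 hk1), mul_nonneg hC₂ (pow_nonneg hθ₂0 (k + 1))]

/-- NOT IN PRINT; OUR BOOKKEEPING (`d = 3`, `2 ≤ Lc`, pin `cE = Lc^4`, UNCONDITIONAL).  **THE TOP-ALIGNED V PAIR AT BIRTH LEVEL `0` NEEDS NO CAUCHY INPUT**: member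
`k+1`'s lineage born at `1` and member `k`'s born at `0` (`k ≥ 1`) are EACH bounded by the two lineage letters (lengths `k`), so their difference is a local
stencil family with constant `C·k·Θ^k` — the `i = 0` instance of §1's `hP` VERBATIM (`q = 1`; indices left raw: `0 + 1 + 1`, `k - 1 - 0`, `0 + 1`, `k - 0`).
The pairs `i ≥ 1` (road S3's rooted V DIFF rows for the undressed part + the differenced (V-C) cells) remain OPEN. -/
theorem exists_pairZero_v_three (hLc : 2 ≤ Lc) {cE : ℝ} (hcE : cE = (Lc : ℝ) ^ (3 + 1)) (cVH : ℝ) :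
    ∃ CP Θ δP : ℝ, 0 ≤ CP ∧ 0 ≤ Θ ∧ Θ < 1 ∧ 0 < δP ∧ ∀ (rr : Fin (3 + 1) → ℕ), rr ∈ box (3 + 1) Lc → ∀ k : ℕ, 0 < k →
      LocStencil
        (transport (unitStepMap Lc (toSite rr) cE) (0 + 1 + 1) (k - 1 - 0)
            (unitStepMap Lc (toSite rr) cE (0 + 1) (fun κ u => cVH • vhSAt (toSite rr) 3 Lc rfl κ u))
          - transport (unitStepMap Lc (toSite rr) cE) (0 + 1) (k - 1 - 0)
            (unitStepMap Lc (toSite rr) cE 0 (fun κ u => cVH • vhSAt (toSite rr) 3 Lc rfl κ u)))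
        (CP * ((((k - 0 : ℕ) : ℝ)) ^ 1 * Θ ^ k)) δP := by
  obtain ⟨C₁, θ₁, C₂, θ₂, δ, hC₁, hθ₁0, hθ₁1, hC₂, hθ₂0, hθ₂1, hδ, hD⟩ := exists_lineage_v_three hLc hcE cVH
  set Θ : ℝ := max θ₁ θ₂ with hΘ
  have hΘ0 : 0 ≤ Θ := le_max_of_le_left hθ₁0
  have hΘ1 : Θ < 1 := max_lt hθ₁1 hθ₂1
  refine ⟨C₁ + C₂ + (C₁ + C₂), Θ, δ, by positivity, hΘ0, hΘ1, hδ, fun rr hrr k hk => ?_⟩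
  have ha := hD rr hrr (k + 1) 1 (by omega)
  have hb := hD rr hrr k 0 hk
  rw [show k + 1 - 1 - 1 = k - 1 by omega, show k + 1 - 1 = k by omega] at ha
  rw [show k - 1 - 0 = k - 1 by omega, show k - 0 = k by omega] at hb
  rw [show k - 1 - 0 = k - 1 by omega, show k - 0 = k by omega, show 0 + 1 + 1 = 1 + 1 from rfl, show (0 : ℕ) + 1 = 1 from rfl]
  have hab := locStencil_sub ha hb
  refine locStencil_mono' hab ?_ le_rfl
  -- `(C₁ θ₁^k + C₂ k θ₂^k) + (C₁ θ₁^k + C₂ k θ₂^k) ≤ (C₁ + C₂ + (C₁ + C₂))·k·Θ^k` for `k ≥ 1`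
  have hk1 : (1 : ℝ) ≤ (k : ℝ) := by exact_mod_cast hk
  have hp1 : θ₁ ^ k ≤ Θ ^ k := pow_le_pow_left₀ hθ₁0 (le_max_left _ _) _
  have hp2 : θ₂ ^ k ≤ Θ ^ k := pow_le_pow_left₀ hθ₂0 (le_max_right _ _) _
  have hTk : 0 ≤ Θ ^ k := pow_nonneg hΘ0 _
  rw [pow_one]
  nlinarith [mul_nonneg hC₁ hTk, mul_nonneg hC₂ hTk, mul_le_mul_of_nonneg_left hp1 hC₁, mul_le_mul_of_nonneg_left hp2 hC₂,
    mul_nonneg (mul_nonneg hC₁ hTk) (sub_nonneg.2 hk1), mul_nonneg hC₂ (pow_nonneg hθ₂0 k)]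

/-- NOT IN PRINT; OUR PROOF ATTEMPT — A SOCKET (`d = 3`, `2 ≤ Lc`, pin `cE = Lc^4`; [folklore] assembly).  **THE RATE HALF `hBdev(cVH,0)` OF THE V-BORN ROW OF THE
`d = 3` COMB FAMILY FROM THE TOP-ALIGNED V PAIR LETTERS ALONE** (`LocStencil` currency, all `i < k`): if for every in-block root and every `i < k` member `k+1`'s
lineage born at `i+1` minus member `k`'s born at `i` is a local stencil family with constant `CP·(k−i)^q·Θ^k` (`Θ < 1`, one rate `δP`), then the unit tables of
`bornSecAt Lc ρ cE cVH 0` obey the all-scales Cauchy letter with ONE `cB`, ONE `θB < 1`, ONE `δB > 0` — the top lineage is TREE (`exists_hT_v_three`).  The pair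
letter is NOT proved here (its `i = 0` member is: `exists_pairZero_v_three`); NOT hSdev of the comb family; NEVER «G-an2-4 closed». -/
theorem exists_hBdevV_three_of_pairs (hLc : 2 ≤ Lc) {cE : ℝ} (hcE : cE = (Lc : ℝ) ^ (3 + 1)) (cVH : ℝ) (q : ℕ)
    (hP : ∃ CP Θ δP : ℝ, 0 ≤ CP ∧ 0 ≤ Θ ∧ Θ < 1 ∧ 0 < δP ∧ ∀ (rr : Fin (3 + 1) → ℕ), rr ∈ box (3 + 1) Lc → ∀ k i : ℕ, i < k →
      LocStencil
        (transport (unitStepMap Lc (toSite rr) cE) (i + 1 + 1) (k - 1 - i)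
            (unitStepMap Lc (toSite rr) cE (i + 1) (fun κ u => cVH • vhSAt (toSite rr) 3 Lc rfl κ u))
          - transport (unitStepMap Lc (toSite rr) cE) (i + 1) (k - 1 - i)
            (unitStepMap Lc (toSite rr) cE i (fun κ u => cVH • vhSAt (toSite rr) 3 Lc rfl κ u)))
        (CP * ((((k - i : ℕ) : ℝ)) ^ q * Θ ^ k)) δP) :
    ∃ cB θB δB : ℝ, 0 ≤ cB ∧ 0 ≤ θB ∧ θB < 1 ∧ 0 < δB ∧ ∀ (rr : Fin (3 + 1) → ℕ), rr ∈ box (3 + 1) Lc → ∀ k j : ℕ,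
      LocStencil (unitS (sfStep Lc (k + j)) (smStep 3 Lc (k + j)) (bornSecAt Lc (toSite rr) cE cVH 0 (k + j))
        - unitS (sfStep Lc k) (smStep 3 Lc k) (bornSecAt Lc (toSite rr) cE cVH 0 k)) (cB * θB ^ k) δB :=
  exists_hBdevV_of_letters (d := 3) cE cVH (exists_hT_v_three hLc hcE cVH) hP

/-- NOT IN PRINT; OUR PROOF ATTEMPT — A SOCKET (`d = 3`, `2 ≤ Lc`, pin `cE = Lc^4`; [folklore] assembly).  **THE RATE HALF `hBdev(cVH,0)` OF THE V-BORN ROW OF THE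
`d = 3` COMB FAMILY FROM THE SUP-NORM V PAIR LETTERS WITH BIRTHS `≥ 1` ALONE**: if for every in-block root, every `1 ≤ i < k` and every entry member `k+1`'s lineage
born at `i+1` minus member `k`'s born at `i` is bounded by `CP·(k−i)^q·Θ^k` (`Θ < 1`; NO decay asked), then the unit tables of `bornSecAt Lc ρ cE cVH 0` obey the
all-scales Cauchy letter `LocStencil (U_{k+j} − U_k) (cB·θB^k) δB` with ONE `cB`, ONE `θB < 1`, ONE `δB > 0` — the uniform letter hB(cVH,0) is the owner's
hypothesis-free `SrecAtRowHoldsFinal.exists_hBv_three`, the top lineage `exists_hT_v_three`, the pair `i = 0` `exists_pairZero_v_three` (decay forgotten; the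
pairs folded with exponent `q+1`).  The pair letters `i ≥ 1` are NOT proved here; NOT hSdev of the comb family; NEVER «G-an2-4 closed». -/
theorem exists_hBdevV_three_of_supPairs (hLc : 2 ≤ Lc) {cE : ℝ} (hcE : cE = (Lc : ℝ) ^ (3 + 1)) (cVH : ℝ) (q : ℕ)
    (hP : ∃ CP Θ : ℝ, 0 ≤ CP ∧ 0 ≤ Θ ∧ Θ < 1 ∧ ∀ (rr : Fin (3 + 1) → ℕ), rr ∈ box (3 + 1) Lc → ∀ k i : ℕ, 1 ≤ i → i < k → ∀ κ u,
      SupBound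
        ((transport (unitStepMap Lc (toSite rr) cE) (i + 1 + 1) (k - 1 - i)
            (unitStepMap Lc (toSite rr) cE (i + 1) (fun κ u => cVH • vhSAt (toSite rr) 3 Lc rfl κ u))
          - transport (unitStepMap Lc (toSite rr) cE) (i + 1) (k - 1 - i)
            (unitStepMap Lc (toSite rr) cE i (fun κ u => cVH • vhSAt (toSite rr) 3 Lc rfl κ u))) κ u)
        (CP * ((((k - i : ℕ) : ℝ)) ^ q * Θ ^ k))) :
    ∃ cB θB δB : ℝ, 0 ≤ cB ∧ 0 ≤ θB ∧ θB < 1 ∧ 0 < δB ∧ ∀ (rr : Fin (3 + 1) → ℕ), rr ∈ box (3 + 1) Lc → ∀ k j : ℕ,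
      LocStencil (unitS (sfStep Lc (k + j)) (smStep 3 Lc (k + j)) (bornSecAt Lc (toSite rr) cE cVH 0 (k + j))
        - unitS (sfStep Lc k) (smStep 3 Lc k) (bornSecAt Lc (toSite rr) cE cVH 0 k)) (cB * θB ^ k) δB := by
  obtain ⟨CT, θT, δT, hCT, hθT0, hθT1, hδT, hT⟩ := exists_hT_v_three hLc hcE cVH
  obtain ⟨C₀, Θ₀, δ₀, hC₀, hΘ₀0, hΘ₀1, hδ₀, h0⟩ := exists_pairZero_v_three hLc hcE cVH
  obtain ⟨CP, Θ, hCP, hΘ0, hΘ1, hP⟩ := hP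
  set Θ' : ℝ := max Θ₀ Θ with hΘ'
  have hΘ'0 : 0 ≤ Θ' := le_max_of_le_left hΘ₀0
  have hΘ'1 : Θ' < 1 := max_lt hΘ₀1 hΘ1
  refine exists_hBdevV_of_supLetters (d := 3) (p := 1) (q := q + 1) cE cVH
    (exists_hBv_three hLc hcE cVH)
    ⟨CT, θT, hCT, hθT0, hθT1, fun rr hrr k => locStencil_zero_iff_supBound.1 (locStencil_zero_of_locStencil (hT rr hrr k) hδT.le)⟩
    ⟨C₀ + CP, Θ', by positivity, hΘ'0, hΘ'1, fun rr hrr k i hik κ u => ?_⟩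
  have hΘk0 : Θ₀ ^ k ≤ Θ' ^ k := pow_le_pow_left₀ hΘ₀0 (le_max_left _ _) k
  have hΘk : Θ ^ k ≤ Θ' ^ k := pow_le_pow_left₀ hΘ0 (le_max_right _ _) k
  have hki : (1 : ℝ) ≤ (((k - i : ℕ) : ℝ)) := by exact_mod_cast Nat.sub_pos_of_lt hik
  cases i with
  | zero =>
      -- the free pair (decay forgotten): `C₀ k Θ₀^k ≤ (C₀ + CP) (k - 0)^(q+1) Θ'^k`
      have h := (locStencil_zero_iff_supBound.1 (locStencil_zero_of_locStencil (h0 rr hrr k hik) hδ₀.le)) κ u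
      refine fun x y a b => (h x y a b).trans ?_
      have hpow : (((k - 0 : ℕ) : ℝ)) ^ 1 ≤ (((k - 0 : ℕ) : ℝ)) ^ (q + 1) := pow_le_pow_right₀ hki (by omega)
      have hq0 : 0 ≤ (((k - 0 : ℕ) : ℝ)) ^ (q + 1) := by positivity
      calc C₀ * ((((k - 0 : ℕ) : ℝ)) ^ 1 * Θ₀ ^ k) ≤ C₀ * ((((k - 0 : ℕ) : ℝ)) ^ (q + 1) * Θ' ^ k) :=
            mul_le_mul_of_nonneg_left (mul_le_mul hpow hΘk0 (pow_nonneg hΘ₀0 k) hq0) hC₀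
        _ ≤ (C₀ + CP) * ((((k - 0 : ℕ) : ℝ)) ^ (q + 1) * Θ' ^ k) :=
            mul_le_mul_of_nonneg_right (le_add_of_nonneg_right hCP) (mul_nonneg hq0 (pow_nonneg hΘ'0 k))
  | succ i =>
      have h := hP rr hrr k (i + 1) (Nat.succ_le_succ (Nat.zero_le i)) hik κ u
      refine fun x y a b => (h x y a b).trans ?_
      have hpow : (((k - (i + 1) : ℕ) : ℝ)) ^ q ≤ (((k - (i + 1) : ℕ) : ℝ)) ^ (q + 1) := pow_le_pow_right₀ hki (by omega)
      have hq0 : 0 ≤ (((k - (i + 1) : ℕ) : ℝ)) ^ (q + 1) := by positivity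
      calc CP * ((((k - (i + 1) : ℕ) : ℝ)) ^ q * Θ ^ k) ≤ CP * ((((k - (i + 1) : ℕ) : ℝ)) ^ (q + 1) * Θ' ^ k) :=
            mul_le_mul_of_nonneg_left (mul_le_mul hpow hΘk (pow_nonneg hΘ0 k) hq0) hCP
        _ ≤ (C₀ + CP) * ((((k - (i + 1) : ℕ) : ℝ)) ^ (q + 1) * Θ' ^ k) :=
            mul_le_mul_of_nonneg_right (le_add_of_nonneg_left hC₀) (mul_nonneg hq0 (pow_nonneg hΘ'0 k))

end Summit.QuantumFields.BalabanUV.Beta.GAN24.BornBorderDriftThree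

end
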